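import Mathlib
import Summits.Ventures.PercRepro2.HCov
import Summits.Ventures.PercRepro2.BHKAvoid
import Summits.Ventures.PercRepro2.BHKOutside
import Summits.Ventures.PercRepro2.ISplit
import Summits.Ventures.PercRepro2.RootLeafUHalf
import Summits.Ventures.PercRepro2.RootLeafUOu
import Summits.Ventures.PercRepro2.RootLeafUClaimI
import Summits.Ventures.PercRepro2.RootLeafUKMaster
import Summits.Ventures.PercRepro2.RootLeafUKSide
import Summits.Ventures.PercRepro2.RootLeafUClaimITp
import Summits.Ventures.PercRepro2.RootLeafUThresholdPD

/-!
# The `PD`-level claim: `Λ ≥ P(bK | PD)` for every instance, and the `K5`-class of the `o ∈ K` half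
(blind cell PercRepro2, p4 g29; S3 (G4-u) item (ap), proofs/P4-G29-PDLEVEL.md)

Vocabulary of RootLeafUKSide / RootLeafUClaimITp (`u = a₁` the root pendant at the unmarked `u`, `c = a₃`):
`Q = {a₂ ↮ u}`, `Z = P(Q)`, `PD = Q ∩ {c ∉ K ∪ L}`, `T = Q ∩ {c ∈ K}`, `T′ = Q ∩ {c ∈ L}` (`K = C(a₂)`, `L = C(u)`),
`D, t, t′` their masses, `R′ = PD ⊔ T′ = {a₂ ↮ u, a₂ ↮ c}`, `R = PD ⊔ T = {u ↮ a₂, u ↮ c}`, `hb = P(a₂ ↔ b)`,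
`d0 = P(a₂ ↮ c)`, `gap = hb − P(u ↔ b)`, `α = D·hb + d0·gap`, `β = D + d0·Z`, `A = κ + α`, `Λ = A/(2β)`,
`δK = t′·P(PD,oK) − D·P(T′,oK)`, `(b) = W′·P(T′,oK,bK) − P(R′,oK)·P(T′,bK)`, `K3 = A·δK + 2β·(b)`.

* **`claim_PD`**: **`D·A ≥ 2β·P(PD, bK)`**, i.e. `Λ ≥ P(bK | PD)` on every finite graph and every weight
  vector — the third level below `Λ` after `P(bK | R)` (`LMaster.claim_i`) and `P(bK | T′)` (`LMaster.claim_i'`);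
  it is ABOVE both of those (`y_{T′} ≤ y_{R′} ≤ y_{PD}`).  Certificate identity (`claim_PD_identity`, a `ring`
  identity after `Qsplit`, `Qsplit_univ`, `gap_eq_Q`):

  `D·A − 2β·P(PD,bK) = 2·[ (D + d0·t′)·(D·hb − P(PD,bK)) + D·(1 − d0)·(t′·hb − P(T′,bK))
                          + D·(P(R′,bL) − d0·P(Q,bL)) + d0·(D·P(T,bK) − t·P(PD,bK)) ]`,

  and the four signs: Harris (`PD` decreasing against `{a₂ ↔ b}`, `ThresholdPD.PDbK_le`); the tower bound
  `P(T′,bK) ≤ t′·hb` (`prob_Tp_bK_le`); `P(R′,bL) ≥ d0·P(Q,bL)` (`RpbL_sub_nonneg`, the `t′`-free form of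
  `LMaster.Tp_mul_RpbL_sub_nonneg`: BHK06 1.4 under `Q` and Harris); and **`T_bK_mul_D_ge`**:
  `t·P(PD,bK) ≤ D·P(T,bK)`, i.e. `P(bK | T) ≥ P(bK | PD)` — the two events `{c ∈ K}`, `{b ∈ K}` of the
  complement of `L = C(u)` are positively correlated given `u ↮ {a₂, c}` (`bhk_two_outside_avoid`, BHK06 1.3
  through the exploration of `L`, with the same outside vertex `a₂` twice).
* **`K3_nonneg_of_K5`** / **`T2oK_nonneg_of_K5`**: with `K5 := P(PD,bK)·δK + D·(b)` (the `PD`-level form of the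
  `o ∈ K` claim: `K5 ≥ 0 ⟺ Cov_{T′}(oK,bK) + (P(oK|R′) − P(oK|T′))·(P(bK|PD) − P(bK|T′)) ≥ 0`), the exact
  identity `D·K3 = (D·A − 2β·P(PD,bK))·δK + 2β·K5` (`D_mul_K3_eq`) and `δK ≥ 0` (`KMaster.deltaK_nonneg`) give
  **`0 ≤ K5 → 0 ≤ K3` when `D > 0`**, hence `0 ≤ T2oK` (`KSide.T2oK_nonneg_of_K3`).  `K5` vanishes IDENTICALLY
  on every «product» instance (the `o`-side and the `b`-side of `K` independent under `P(· | R′)` and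
  `P(u ↮ c | K)` a product of an `o`-side and a `b`-side factor — the dilute two-route gadgets, the direct
  two-route family), so this class contains every such instance; `K5 < 0` is possible (p4 g25's exact witness,
  `−5.9·10⁻¹¹`), and there the `o ∈ K` half needs `(D·A − 2β·P(PD,bK))·δK ≥ 2β·|K5|`.
-/

namespace Summit.Ventures.PercRepro2

open UnionCluster CovForm

namespace RootLeafU

namespace PDLevel

variable {V : Type*} {E : Type*} [Fintype E] [DecidableEq E] [Fintype V] [DecidableEq V]
  {R : Type*} [Field R] [LinearOrder R] [IsStrictOrderedRing R]

variable (p : E → R) (ends : E → Sym2 V) (a₂ c b u : V)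

omit [Fintype E] [DecidableEq E] [Fintype V] [LinearOrder R] [IsStrictOrderedRing R] in
/-- `{a₂ ↔ c} ∩ {u ↮ {a₂, c}} = T`. -/
lemma cK_inter_R_eq_T : connEvent ends a₂ c ∩ avoidAll ends u {a₂, c} = TEvent ends u a₂ c := by
  rw [ISplit.T_eq_R_inter, Set.inter_comm]

omit [Fintype E] [DecidableEq E] [Fintype V] [LinearOrder R] [IsStrictOrderedRing R] in
/-- `{a₂ ↔ c} ∩ {a₂ ↔ b} ∩ {u ↮ {a₂, c}} = T ∩ {a₂ ↔ b}`. -/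
lemma cK_inter_bK_inter_R_eq_T_bK :
    connEvent ends a₂ c ∩ connEvent ends a₂ b ∩ avoidAll ends u {a₂, c} =
      TEvent ends u a₂ c ∩ connEvent ends a₂ b := by
  rw [ISplit.T_eq_R_inter]
  ext ω
  simp only [Set.mem_inter_iff]
  tauto

omit [DecidableEq V] in
/-- **`P(bK | T) ≥ P(bK | PD)`**: `t·P(PD,bK) ≤ D·P(T,bK)` — the two events `{c ∈ K}` and `{b ∈ K}` of the
complement of `L = C(u)` are positively correlated given `u ↮ {a₂, c}` (`bhk_two_outside_avoid` with the
same outside vertex `a₂` in both slots). -/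
theorem T_bK_mul_D_ge (hp : IsProbVec p) :
    prob p (TEvent ends u a₂ c) * prob p (PDEvent ends u a₂ c ∩ connEvent ends a₂ b) ≤
      prob p (PDEvent ends u a₂ c) * prob p (TEvent ends u a₂ c ∩ connEvent ends a₂ b) := by
  classical
  have h := bhk_two_outside_avoid p hp ends u a₂ a₂ ({a₂, c} : Finset V)
    (isUpperSet_mem_setOf c) (isUpperSet_mem_setOf b)
  have e : insert a₂ ({a₂, c} : Finset V) = {a₂, c} :=
    Finset.insert_eq_of_mem (Finset.mem_insert_self a₂ {c})
  simp only [e] at h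
  rw [← connEvent_eq_clusterInEvent ends a₂ c, ← connEvent_eq_clusterInEvent ends a₂ b,
    cK_inter_R_eq_T, cK_inter_bK_inter_R_eq_T_bK, Set.inter_comm (connEvent ends a₂ b)] at h
  have hR := ISplit.prob_PD_add_T p ends u a₂ c Set.univ
  simp only [Set.inter_univ] at hR
  have hRb := ISplit.prob_PD_add_T p ends u a₂ c (connEvent ends a₂ b)
  rw [← hR, ← hRb] at h
  nlinarith [h]

omit [DecidableEq V] in
/-- **`P(R′, bL) ≥ d0·P(Q, bL)`** (`P(a₂ ↮ c | Q, u ↔ b) ≥ P(a₂ ↮ c)`), in the split masses and without the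
factor `t′` of `LMaster.Tp_mul_RpbL_sub_nonneg`:
`0 ≤ (P(PD,bL) + P(T′,bL)) − d0·(P(PD,bL) + P(T,bL) + P(T′,bL))`. -/
lemma RpbL_sub_nonneg (hp : IsProbVec p) :
    0 ≤ (prob p (PDEvent ends u a₂ c ∩ connEvent ends u b) + prob p (TEvent ends a₂ u c ∩ connEvent ends u b)) - prob p (avoidAll ends a₂ {c}) * (prob p (PDEvent ends u a₂ c ∩ connEvent ends u b) + prob p (TEvent ends u a₂ c ∩ connEvent ends u b) + prob p (TEvent ends a₂ u c ∩ connEvent ends u b)) := by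
  classical
  have hbL := Qsplit p ends u a₂ c (connEvent ends u b)
  have hd0 : prob p (avoidAll ends a₂ {c}) = 1 - prob p (connEvent ends a₂ c) := by
    rw [LMaster.avoid_c_eq_compl, prob_compl]
  have H1 := LMaster.T_bL_mul_Z_le p ends a₂ c b u hp
  have H2 := LMaster.T_le_Z_mul p ends a₂ c u hp
  have n_Z := prob_nonneg hp (avoidAll ends a₂ {u})
  have n_QbL := prob_nonneg hp (avoidAll ends a₂ {u} ∩ connEvent ends u b)
  have n_PDbL := prob_nonneg hp (PDEvent ends u a₂ c ∩ connEvent ends u b)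
  have n_TbL := prob_nonneg hp (TEvent ends u a₂ c ∩ connEvent ends u b)
  have n_TpbL := prob_nonneg hp (TEvent ends a₂ u c ∩ connEvent ends u b)
  have hQbL_le : prob p (avoidAll ends a₂ {u} ∩ connEvent ends u b) ≤ prob p (avoidAll ends a₂ {u}) :=
    prob_mono hp Set.inter_subset_left
  -- `Z · ((1 − d0)·P(Q,bL) − P(T,bL)) ≥ 0`
  have key : 0 ≤ prob p (avoidAll ends a₂ {u}) *
      ((1 - prob p (avoidAll ends a₂ {c})) * prob p (avoidAll ends a₂ {u} ∩ connEvent ends u b) -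
        prob p (TEvent ends u a₂ c ∩ connEvent ends u b)) := by
    rw [hd0]
    nlinarith [H1, H2, n_QbL, n_Z]
  rw [← hbL]
  rcases eq_or_lt_of_le n_Z with hZ0 | hZpos
  · -- `Z = 0` forces every `Q`-mass to vanish
    have hQ0 : prob p (avoidAll ends a₂ {u} ∩ connEvent ends u b) = 0 :=
      le_antisymm (hZ0 ▸ hQbL_le) n_QbL
    rw [hQ0] at hbL ⊢
    have h1 : prob p (PDEvent ends u a₂ c ∩ connEvent ends u b) = 0 := by linarith
    have h2 : prob p (TEvent ends a₂ u c ∩ connEvent ends u b) = 0 := by linarith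
    rw [h1, h2]
    simp
  · have hX : 0 ≤ (1 - prob p (avoidAll ends a₂ {c})) * prob p (avoidAll ends a₂ {u} ∩ connEvent ends u b) -
        prob p (TEvent ends u a₂ c ∩ connEvent ends u b) :=
      (mul_nonneg_iff_of_pos_left hZpos).mp key
    linarith [hbL, hX]

omit [Fintype V] in
/-- **The certificate identity of the `PD`-level claim**: `D·A − 2β·P(PD,bK)` is twice the sum of four terms. -/
theorem claim_PD_identity :
    prob p (PDEvent ends u a₂ c) * ((prob p (PDEvent ends u a₂ c) * prob p (connEvent ends a₂ b) + prob p (avoidAll ends a₂ {c}) * gap p ends u a₂ b) + (prob p Set.univ * EQb3 p ends u a₂ c b + prob p Set.univ * PDb p ends u a₂ c b + prob p (connEvent ends a₂ b) * EQ3 p ends u a₂ c + prob p (connEvent ends a₂ b) * prob p (avoidAll ends a₂ {u}) - (prob p Set.univ - prob p (avoidAll ends a₂ {c})) * gap p ends u a₂ b)) - 2 * (prob p Set.univ * prob p (PDEvent ends u a₂ c) + prob p (avoidAll ends a₂ {c}) * prob p (avoidAll ends a₂ {u})) * prob p (PDEvent ends u a₂ c ∩ connEvent ends a₂ b) =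
      2 * ((prob p (PDEvent ends u a₂ c) + prob p (avoidAll ends a₂ {c}) * prob p (TEvent ends a₂ u c)) * (prob p (PDEvent ends u a₂ c) * prob p (connEvent ends a₂ b) - prob p (PDEvent ends u a₂ c ∩ connEvent ends a₂ b)) + prob p (PDEvent ends u a₂ c) * (1 - prob p (avoidAll ends a₂ {c})) * (prob p (TEvent ends a₂ u c) * prob p (connEvent ends a₂ b) - prob p (TEvent ends a₂ u c ∩ connEvent ends a₂ b)) + prob p (PDEvent ends u a₂ c) * ((prob p (PDEvent ends u a₂ c ∩ connEvent ends u b) + prob p (TEvent ends a₂ u c ∩ connEvent ends u b)) - prob p (avoidAll ends a₂ {c}) * (prob p (PDEvent ends u a₂ c ∩ connEvent ends u b) + prob p (TEvent ends u a₂ c ∩ connEvent ends u b) + prob p (TEvent ends a₂ u c ∩ connEvent ends u b))) + prob p (avoidAll ends a₂ {c}) * (prob p (PDEvent ends u a₂ c) * prob p (TEvent ends u a₂ c ∩ connEvent ends a₂ b) - prob p (TEvent ends u a₂ c) * prob p (PDEvent ends u a₂ c ∩ connEvent ends a₂ b))) := by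
  have hZ := Qsplit_univ p ends u a₂ c
  have hbK := Qsplit p ends u a₂ c (connEvent ends a₂ b)
  have hbL := Qsplit p ends u a₂ c (connEvent ends u b)
  have hgap := gap_eq_Q p ends u a₂ b
  unfold EQb3 PDb EQ3
  rw [hgap, hZ, hbK, hbL, prob_univ]
  ring

/-- **The `PD`-level claim for every instance**: `0 ≤ D·A − 2β·P(PD, bK)`, i.e. `Λ = A/(2β) ≥ P(bK | PD)`. -/
theorem claim_PD (hp : IsProbVec p) :
    0 ≤ prob p (PDEvent ends u a₂ c) * ((prob p (PDEvent ends u a₂ c) * prob p (connEvent ends a₂ b) + prob p (avoidAll ends a₂ {c}) * gap p ends u a₂ b) + (prob p Set.univ * EQb3 p ends u a₂ c b + prob p Set.univ * PDb p ends u a₂ c b + prob p (connEvent ends a₂ b) * EQ3 p ends u a₂ c + prob p (connEvent ends a₂ b) * prob p (avoidAll ends a₂ {u}) - (prob p Set.univ - prob p (avoidAll ends a₂ {c})) * gap p ends u a₂ b)) - 2 * (prob p Set.univ * prob p (PDEvent ends u a₂ c) + prob p (avoidAll ends a₂ {c}) * prob p (avoidAll ends a₂ {u})) * prob p (PDEvent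 ends u a₂ c ∩ connEvent ends a₂ b) := by
  classical
  rw [claim_PD_identity]
  have n_D := prob_nonneg hp (PDEvent ends u a₂ c)
  have n_tp := prob_nonneg hp (TEvent ends a₂ u c)
  have n_d0 := prob_nonneg hp (avoidAll ends a₂ {c})
  have hd0_le := prob_le_one hp (avoidAll ends a₂ {c})
  -- (g1) Harris: `P(PD,bK) ≤ hb·D`, times `D + d0·t′ ≥ 0`
  have H1 := ThresholdPD.PDbK_le p ends a₂ c b u hp
  have g1 : 0 ≤ (prob p (PDEvent ends u a₂ c) + prob p (avoidAll ends a₂ {c}) * prob p (TEvent ends a₂ u c)) * (prob p (PDEvent ends u a₂ c) * prob p (connEvent ends a₂ b) - prob p (PDEvent ends u a₂ c ∩ connEvent ends a₂ b)) :=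
    mul_nonneg (add_nonneg n_D (mul_nonneg n_d0 n_tp)) (by linarith)
  -- (g2) the tower bound `P(T′,bK) ≤ t′·hb`, times `D·(1 − d0) ≥ 0`
  have H2 := prob_Tp_bK_le p ends a₂ c b u hp
  have g2 : 0 ≤ prob p (PDEvent ends u a₂ c) * (1 - prob p (avoidAll ends a₂ {c})) * (prob p (TEvent ends a₂ u c) * prob p (connEvent ends a₂ b) - prob p (TEvent ends a₂ u c ∩ connEvent ends a₂ b)) :=
    mul_nonneg (mul_nonneg n_D (by linarith)) (by linarith)
  -- (g3) `P(R′,bL) ≥ d0·P(Q,bL)`, times `D ≥ 0`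
  have g3 : 0 ≤ prob p (PDEvent ends u a₂ c) * ((prob p (PDEvent ends u a₂ c ∩ connEvent ends u b) + prob p (TEvent ends a₂ u c ∩ connEvent ends u b)) - prob p (avoidAll ends a₂ {c}) * (prob p (PDEvent ends u a₂ c ∩ connEvent ends u b) + prob p (TEvent ends u a₂ c ∩ connEvent ends u b) + prob p (TEvent ends a₂ u c ∩ connEvent ends u b))) :=
    mul_nonneg n_D (RpbL_sub_nonneg p ends a₂ c b u hp)
  -- (g4) `P(bK | T) ≥ P(bK | PD)`, times `d0 ≥ 0`
  have H4 := T_bK_mul_D_ge p ends a₂ c b u hp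
  have g4 : 0 ≤ prob p (avoidAll ends a₂ {c}) * (prob p (PDEvent ends u a₂ c) * prob p (TEvent ends u a₂ c ∩ connEvent ends a₂ b) - prob p (TEvent ends u a₂ c) * prob p (PDEvent ends u a₂ c ∩ connEvent ends a₂ b)) :=
    mul_nonneg n_d0 (by linarith)
  linarith

end PDLevel

namespace KSide

variable {V : Type*} {E : Type*} [Fintype E] [DecidableEq E] [Fintype V] [DecidableEq V]
  {R : Type*} [Field R] [LinearOrder R] [IsStrictOrderedRing R]

variable (p : E → R) (ends : E → Sym2 V) (o a₂ c b u : V)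

omit [DecidableEq V] [Fintype V] [LinearOrder R] [IsStrictOrderedRing R] in
/-- **`D·K3 = (D·A − 2β·P(PD,bK))·δK + 2β·K5`** with `K5 = P(PD,bK)·δK + D·(b)` (a `ring` identity). -/
theorem D_mul_K3_eq :
    prob p (PDEvent ends u a₂ c) * (((prob p (PDEvent ends u a₂ c) * prob p (connEvent ends a₂ b) + prob p (avoidAll ends a₂ {c}) * gap p ends u a₂ b) + (prob p Set.univ * EQb3 p ends u a₂ c b + prob p Set.univ * PDb p ends u a₂ c b + prob p (connEvent ends a₂ b) * EQ3 p ends u a₂ c + prob p (connEvent ends a₂ b) * prob p (avoidAll ends a₂ {u}) - (prob p Set.univ - prob p (avoidAll ends a₂ {c})) * gap p ends u a₂ b)) * (prob p (TEvent ends a₂ u c) * prob p (PDEvent ends u a₂ c ∩ connEvent ends a₂ o) - prob p (PDEvent ends u a₂ c) * prob p (TEvent ends a₂ u c ∩ connEvent ends a₂ o)) + 2 * (prob p Set.univ * prob p (PDEvent ends u a₂ c) + prob p (avoidAll ends a₂ {c}) * prob p (avoidAll ends a₂ {u})) * ((prob p (PDEvent ends u a₂ c) + prob p (TEvent ends a₂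 u c)) * prob p (TEvent ends a₂ u c ∩ (connEvent ends a₂ o ∩ connEvent ends a₂ b)) - (prob p (PDEvent ends u a₂ c ∩ connEvent ends a₂ o) + prob p (TEvent ends a₂ u c ∩ connEvent ends a₂ o)) * prob p (TEvent ends a₂ u c ∩ connEvent ends a₂ b))) =
      (prob p (PDEvent ends u a₂ c) * ((prob p (PDEvent ends u a₂ c) * prob p (connEvent ends a₂ b) + prob p (avoidAll ends a₂ {c}) * gap p ends u a₂ b) + (prob p Set.univ * EQb3 p ends u a₂ c b + prob p Set.univ * PDb p ends u a₂ c b + prob p (connEvent ends a₂ b) * EQ3 p ends u a₂ c + prob p (connEvent ends a₂ b) * prob p (avoidAll ends a₂ {u}) - (prob p Set.univ - prob p (avoidAll ends a₂ {c})) * gap p ends u a₂ b)) - 2 * (prob p Set.univ * prob p (PDEvent ends u a₂ c) + prob p (avoidAll ends a₂ {c}) * prob p (avoidAll ends a₂ {u})) * prob p (PDEvent ends u a₂ c ∩ connEvent ends a₂ b)) * (prob p (TEvent ends a₂ u c) * prob p (PDEvent ends u a₂ c ∩ connEvent ends a₂ o) - prob p (PDEvent ends u a₂ c) * prob p (TEvent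 ends a₂ u c ∩ connEvent ends a₂ o)) + 2 * (prob p Set.univ * prob p (PDEvent ends u a₂ c) + prob p (avoidAll ends a₂ {c}) * prob p (avoidAll ends a₂ {u})) * (prob p (PDEvent ends u a₂ c ∩ connEvent ends a₂ b) * (prob p (TEvent ends a₂ u c) * prob p (PDEvent ends u a₂ c ∩ connEvent ends a₂ o) - prob p (PDEvent ends u a₂ c) * prob p (TEvent ends a₂ u c ∩ connEvent ends a₂ o)) + prob p (PDEvent ends u a₂ c) * ((prob p (PDEvent ends u a₂ c) + prob p (TEvent ends a₂ u c)) * prob p (TEvent ends a₂ u c ∩ (connEvent ends a₂ o ∩ connEvent ends a₂ b)) - (prob p (PDEvent ends u a₂ c ∩ connEvent ends a₂ o) + prob p (TEvent ends a₂ u c ∩ connEvent ends a₂ o)) * prob p (TEvent ends a₂ u c ∩ connEvent ends a₂ b))) := by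
  ring

/-- **`0 ≤ D·K3` on the `K5`-class**: `0 ≤ K5 := P(PD,bK)·δK + D·(b)` gives `0 ≤ D·K3` for every instance
(`claim_PD`, `δK ≥ 0`, `β ≥ 0`). -/
theorem D_mul_K3_nonneg_of_K5 (hp : IsProbVec p)
    (hK5 : 0 ≤ prob p (PDEvent ends u a₂ c ∩ connEvent ends a₂ b) * (prob p (TEvent ends a₂ u c) * prob p (PDEvent ends u a₂ c ∩ connEvent ends a₂ o) - prob p (PDEvent ends u a₂ c) * prob p (TEvent ends a₂ u c ∩ connEvent ends a₂ o)) + prob p (PDEvent ends u a₂ c) * ((prob p (PDEvent ends u a₂ c) + prob p (TEvent ends a₂ u c)) * prob p (TEvent ends a₂ u c ∩ (connEvent ends a₂ o ∩ connEvent ends a₂ b)) - (prob p (PDEvent ends u a₂ c ∩ connEvent ends a₂ o) + prob p (TEvent ends a₂ u c ∩ connEvent ends a₂ o)) * prob p (TEvent ends a₂ u c ∩ connEvent ends a₂ b))) :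
    0 ≤ prob p (PDEvent ends u a₂ c) * (((prob p (PDEvent ends u a₂ c) * prob p (connEvent ends a₂ b) + prob p (avoidAll ends a₂ {c}) * gap p ends u a₂ b) + (prob p Set.univ * EQb3 p ends u a₂ c b + prob p Set.univ * PDb p ends u a₂ c b + prob p (connEvent ends a₂ b) * EQ3 p ends u a₂ c + prob p (connEvent ends a₂ b) * prob p (avoidAll ends a₂ {u}) - (prob p Set.univ - prob p (avoidAll ends a₂ {c})) * gap p ends u a₂ b)) * (prob p (TEvent ends a₂ u c) * prob p (PDEvent ends u a₂ c ∩ connEvent ends a₂ o) - prob p (PDEvent ends u a₂ c) * prob p (TEvent ends a₂ u c ∩ connEvent ends a₂ o)) + 2 * (prob p Set.univ * prob p (PDEvent ends u a₂ c) + prob p (avoidAll ends a₂ {c}) * prob p (avoidAll ends a₂ {u})) * ((prob p (PDEvent ends u a₂ c) + prob p (TEvent ends a₂ u c)) * prob p (TEvent ends a₂ u c ∩ (connEvent ends a₂ o ∩ connEvent ends a₂ b)) - (prob p (PDEvent ends u a₂ c ∩ connEvent ends a₂ o) + prob p (TEvent ends a₂ u c ∩ connEvent ends a₂ o)) * prob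 p (TEvent ends a₂ u c ∩ connEvent ends a₂ b))) := by
  classical
  rw [D_mul_K3_eq]
  have hPD := PDLevel.claim_PD p ends a₂ c b u hp
  have hdK := KMaster.deltaK_nonneg p ends o a₂ c u hp
  have n_D := prob_nonneg hp (PDEvent ends u a₂ c)
  have n_d0 := prob_nonneg hp (avoidAll ends a₂ {c})
  have n_Z := prob_nonneg hp (avoidAll ends a₂ {u})
  have n_β : 0 ≤ (prob p Set.univ * prob p (PDEvent ends u a₂ c) + prob p (avoidAll ends a₂ {c}) * prob p (avoidAll ends a₂ {u})) := by
    rw [prob_univ]; nlinarith [n_D, n_d0, n_Z]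
  exact add_nonneg (mul_nonneg hPD hdK) (mul_nonneg (mul_nonneg (by norm_num) n_β) hK5)

/-- **The `K5`-class of the `o ∈ K` half**: `0 ≤ K3` whenever `D > 0` and `0 ≤ K5 = P(PD,bK)·δK + D·(b)`
(`K5 = 0` on every product instance). -/
theorem K3_nonneg_of_K5 (hp : IsProbVec p) (hD : 0 < prob p (PDEvent ends u a₂ c))
    (hK5 : 0 ≤ prob p (PDEvent ends u a₂ c ∩ connEvent ends a₂ b) * (prob p (TEvent ends a₂ u c) * prob p (PDEvent ends u a₂ c ∩ connEvent ends a₂ o) - prob p (PDEvent ends u a₂ c) * prob p (TEvent ends a₂ u c ∩ connEvent ends a₂ o)) + prob p (PDEvent ends u a₂ c) * ((prob p (PDEvent ends u a₂ c) + prob p (TEvent ends a₂ u c)) * prob p (TEvent ends a₂ u c ∩ (connEvent ends a₂ o ∩ connEvent ends a₂ b)) - (prob p (PDEvent ends u a₂ c ∩ connEvent ends a₂ o) + prob p (TEvent ends a₂ u c ∩ connEvent ends a₂ o)) * prob p (TEvent ends a₂ u c ∩ connEvent ends a₂ b))) :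
    0 ≤ (((prob p (PDEvent ends u a₂ c) * prob p (connEvent ends a₂ b) + prob p (avoidAll ends a₂ {c}) * gap p ends u a₂ b) + (prob p Set.univ * EQb3 p ends u a₂ c b + prob p Set.univ * PDb p ends u a₂ c b + prob p (connEvent ends a₂ b) * EQ3 p ends u a₂ c + prob p (connEvent ends a₂ b) * prob p (avoidAll ends a₂ {u}) - (prob p Set.univ - prob p (avoidAll ends a₂ {c})) * gap p ends u a₂ b)) * (prob p (TEvent ends a₂ u c) * prob p (PDEvent ends u a₂ c ∩ connEvent ends a₂ o) - prob p (PDEvent ends u a₂ c) * prob p (TEvent ends a₂ u c ∩ connEvent ends a₂ o)) + 2 * (prob p Set.univ * prob p (PDEvent ends u a₂ c) + prob p (avoidAll ends a₂ {c}) * prob p (avoidAll ends a₂ {u})) * ((prob p (PDEvent ends u a₂ c) + prob p (TEvent ends a₂ u c)) * prob p (TEvent ends a₂ u c ∩ (connEvent ends a₂ o ∩ connEvent ends a₂ b)) - (prob p (PDEvent ends u a₂ c ∩ connEvent ends a₂ o) + prob p (TEvent ends a₂ u c ∩ connEvent ends a₂ o)) * prob p (TEvent ends a₂ u c ∩ connEvent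 ends a₂ b))) :=
  (mul_nonneg_iff_of_pos_left hD).mp (D_mul_K3_nonneg_of_K5 p ends o a₂ c b u hp hK5)

/-- **`0 ≤ T2oK` on the `K5`-class.** -/
theorem T2oK_nonneg_of_K5 (hp : IsProbVec p) (hD : 0 < prob p (PDEvent ends u a₂ c))
    (hK5 : 0 ≤ prob p (PDEvent ends u a₂ c ∩ connEvent ends a₂ b) * (prob p (TEvent ends a₂ u c) * prob p (PDEvent ends u a₂ c ∩ connEvent ends a₂ o) - prob p (PDEvent ends u a₂ c) * prob p (TEvent ends a₂ u c ∩ connEvent ends a₂ o)) + prob p (PDEvent ends u a₂ c) * ((prob p (PDEvent ends u a₂ c) + prob p (TEvent ends a₂ u c)) * prob p (TEvent ends a₂ u c ∩ (connEvent ends a₂ o ∩ connEvent ends a₂ b)) - (prob p (PDEvent ends u a₂ c ∩ connEvent ends a₂ o) + prob p (TEvent ends a₂ u c ∩ connEvent ends a₂ o)) * prob p (TEvent ends a₂ u c ∩ connEvent ends a₂ b))) :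
    0 ≤ T2oK p ends o a₂ c b u :=
  T2oK_nonneg_of_K3 p ends o a₂ c b u hp (K3_nonneg_of_K5 p ends o a₂ c b u hp hD hK5)

end KSide

end RootLeafU

end Summit.Ventures.PercRepro2
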